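import Summits.FinalStateConjecture.FinalStateConjecture.Theorems.SwallowTheDatumKerrShieldedDataExistStubCapFarH
import Literature.Geometry.Lorentzian.UnitNormalUniqueness
import HarnessLib

/-!
# `KerrShieldedDataExist`, line `plug-the-second-sheet` (skeleton v4 "KerrCap") — stub `stub_capFarK`, II:
# lapse and shift of the Boyer–Lindquist slicing along the far zone of the cap

Support file (`--supports stmt-FinalStateConjecture-10055`; everything proved, no definitions, no named facts)
for the registered stub `stub_capFarK` of `Cruxes/KerrShieldedDataExist/Lines/plug_the_second_sheet.lean`.

On the far zone `s = ‖u‖ > σ₅` the cap map `Φ(u) = (τ(s), X u)` parametrises the Boyer–Lindquist slice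
`{t_BL = c}` of Kerr(`M, a`) by quasi-isotropic Cartesian coordinates (`r = ϱ(s) = s + M + (M² − a²)/4s`,
`θ = θ_u`, `φ_BL = φ_u`). The stationary Killing vector `∂_{t*} = ∂_{t_BL}` of the Kerr–Schild chart splits
along the slice into lapse and shift, `∂_t = N_l ν + β^φ ∂_φ` with `N_l² = ΣΔ/A`, `β^φ = −2Mar/A`,
`A = (r² + a²)² − Δa² sin²θ` (Bardeen–Press–Teukolsky 1972, (2.3)–(2.5)), and `∂_φ = DΦ(ẑ × u)`. In the Cartesian
atoms of the cap (`Σ_s = r²s² + a²u₂² = s²Σ`, `A_s = (r² + a²)²s² − Δa²(s² − u₂²) = s²A`, `ω(w) = u₀w₁ − u₁w₀`),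
with the SHIFT FIELD `b u = β ẑ × u`, `β = −2Mras²/A_s`, and the INVERSE LAPSE `m = (A_s/(Σ_sΔ))^{1/2}`
(both given by hypotheses-with-equations; no definition is introduced):
* `KerrCap.bilin_basisVector_fderiv_capFar`: `g(∂_{t*}, DΦ w) = −2Mra ω(w)/Σ_s`;
* `KerrCap.bilin_shift_fderiv_capFar`: `g(DΦ b, DΦ w) = −2Mra ω(w)/Σ_s` (closed form of `h`);
* `KerrCap.capFar_lapseShift`: `∂_{t*} − DΦ b ⊥ DΦ(E3)`, `g(m(∂_{t*} − DΦ b), m(∂_{t*} − DΦ b)) = −1`,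
  `g(V, m(∂_{t*} − DΦ b)) = −m < 0`;
* `KerrCap.capFar_normal_eq`: hence ANY future unit normal field `N` along the cap map equals `m(∂_{t*} − DΦ b)`
  at every far point (uniqueness of the future unit normal, `UnitNormalUniqueness.lean`).

References: Bardeen–Press–Teukolsky, ApJ 178 (1972) 347; Brandt–Seidel, PRD 54 (1996) 1403, §II; Wald 1984, §10.2.
-/

-- the doubled `FinalStateConjecture` path component is the summit/problem naming scheme, not a mistake
set_option linter.dupNamespace false

noncomputable section

open Set Function Filter Topology TopologicalSpace
open scoped Manifold ContDiff Topology InnerProductSpace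
open Literature.Geometry.Lorentzian
open Summit.FinalStateConjecture.FinalStateConjecture.Theorems.KerrShieldedDataExist

namespace Summit.FinalStateConjecture.FinalStateConjecture.Theorems.SwallowTheDatum

namespace KerrCap

/-! ### Scalar identities of the far zone, `k` half -/

/-- **`g(∂_{t*}, DΦ w) = −2Mra ω(w)/Σ_s`**, scalar form: with `τ′ = (2Mr/Δ)ϱ′`, `α′ = (a/Δ)ϱ′`, `H = Mrs²/Σ_s`
(`Σ_s = r²s² + a²u₂²`) and the `ℓ`-contraction of `KerrCap.capFar_ell`, the `⟪u, w⟫`-terms of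
`−τ′⟪u,w⟫/s + 2H ℓ(DΦ w)` cancel. [folklore] -/
theorem capFarK_e0 {M a r s S Δ dϱ dτ dα iw ωw u2 : ℝ} (hs : s ≠ 0) (hS : S ≠ 0) (hΔ : Δ ≠ 0)
    (hSdef : S = r ^ 2 * s ^ 2 + a ^ 2 * u2 ^ 2) (hΔdef : Δ = r ^ 2 - 2 * M * r + a ^ 2)
    (hdτ : dτ = 2 * M * r / Δ * dϱ) (hdα : dα = a / Δ * dϱ) :
    -(dτ * s⁻¹ * iw) + 2 * (M * r * s ^ 2 / S) *
        (1 * (dτ * s⁻¹ * iw + s⁻¹ * ((s ^ 2 * r * iw - s ^ 2 * a * ωw +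
          iw * ((s * dϱ - r) * s ^ 2 - s * dα * a * (s ^ 2 - u2 ^ 2))) / s ^ 3))) =
      -(2 * M * r * a / S) * ωw := by
  subst hdτ hdα
  field_simp
  rw [hSdef, hΔdef]
  ring

/-- **`h(b, w) = −2Mra ω(w)/Σ_s`** for the shift `b = β ẑ × u`, `β = −2Mras²/A_s`, scalar form:
`(Σ_s/s⁴)βω(w) + a²(r²s² + 2Mrs² + a²u₂²)/(Σ_s s⁴) · β(s² − u₂²) ω(w) = βω(w)A_s/(Σ_s s²)`,
`A_s = (r² + a²)²s² − Δa²(s² − u₂²)`. [folklore] -/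
theorem capFarK_shift {M a r s S A β ωw u2 : ℝ} (hs : s ≠ 0) (hS : S ≠ 0) (hA : A ≠ 0)
    (hSdef : S = r ^ 2 * s ^ 2 + a ^ 2 * u2 ^ 2)
    (hAdef : A = (r ^ 2 + a ^ 2) ^ 2 * s ^ 2 - (r ^ 2 - 2 * M * r + a ^ 2) * a ^ 2 * (s ^ 2 - u2 ^ 2))
    (hβ : β = -(2 * M * r * a * s ^ 2 / A)) :
    S / s ^ 4 * (β * ωw) + a ^ 2 * (r ^ 2 * s ^ 2 + 2 * M * r * s ^ 2 + a ^ 2 * u2 ^ 2) / (S * s ^ 4) *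
        ((β * (s ^ 2 - u2 ^ 2)) * ωw) =
      -(2 * M * r * a / S) * ωw := by
  subst hβ
  field_simp
  rw [hSdef, hAdef]
  ring

/-- **`g(∂_{t*} − DΦ b, ∂_{t*} − DΦ b) = −Σ_sΔ/A_s`**, scalar form: `−1 + 2H − g(∂_{t*}, DΦ b)` with
`g(∂_{t*}, DΦ b) = −2Mra β(s² − u₂²)/Σ_s`. [folklore] -/
theorem capFarK_unit {M a r s S A Δ β u2 : ℝ} (hS : S ≠ 0) (hA : A ≠ 0)
    (hSdef : S = r ^ 2 * s ^ 2 + a ^ 2 * u2 ^ 2) (hΔdef : Δ = r ^ 2 - 2 * M * r + a ^ 2)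
    (hAdef : A = (r ^ 2 + a ^ 2) ^ 2 * s ^ 2 - (r ^ 2 - 2 * M * r + a ^ 2) * a ^ 2 * (s ^ 2 - u2 ^ 2))
    (hβ : β = -(2 * M * r * a * s ^ 2 / A)) :
    -1 + 2 * (M * r * s ^ 2 / S) * (1 * 1) - -(2 * M * r * a / S) * (β * (s ^ 2 - u2 ^ 2)) =
      -(S * Δ / A) := by
  subst hβ hΔdef
  field_simp
  rw [hSdef, hAdef]
  ring

/-- `A_s = Δ Σ_s + 2Mrs²(r² + a²)` (whence `A_s > 0` outside the horizon). [folklore] -/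
theorem capFarK_A_eq (M a r s u2 : ℝ) :
    (r ^ 2 + a ^ 2) ^ 2 * s ^ 2 - (r ^ 2 - 2 * M * r + a ^ 2) * a ^ 2 * (s ^ 2 - u2 ^ 2) =
      (r ^ 2 - 2 * M * r + a ^ 2) * (r ^ 2 * s ^ 2 + a ^ 2 * u2 ^ 2) + 2 * M * r * s ^ 2 * (r ^ 2 + a ^ 2) := by ring

/-! ### The Killing vector `∂_{t*}` against the tangent vectors of the cap, far zone -/

section Far

variable {M a c σ₅ : ℝ} {τ ϱ α : ℝ → ℝ} {X : E3 → E3}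

/-- **`g(∂_{t*}, DΦ(u) w) = −2Mra(u₀w₁ − u₁w₀)/Σ_s`** on the far zone (`Σ_s = r²s² + a²u₂²`, `r = ϱ(s)`): the
Killing vector `∂_{t*} = ∂_{t_BL}` pairs with the Boyer–Lindquist slice only through the shift
`β = −(2Mar/A)∂_φ` (`g_{tφ} = −2Mar sin²θ/Σ`). Bardeen–Press–Teukolsky 1972, (2.1)–(2.5).
[cite: BrandtSeidel1996, §II] -/
theorem bilin_basisVector_fderiv_capFar (ha : |a| < M) (hσ₅ : 0 < σ₅)
    (hτ : ContDiff ℝ ∞ τ) (hϱ : ContDiff ℝ ∞ ϱ) (hα : ContDiff ℝ ∞ α)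
    (hfar : ∀ s, σ₅ ≤ s → τ s = Negative.bentHeight M a (ϱ s) + c ∧
      ϱ s = s + M + (M ^ 2 - a ^ 2) / (4 * s) ∧
      α s = a / (Kerr.rPlus M a - Kerr.rMinus M a) *
        Real.log ((ϱ s - Kerr.rPlus M a) / (ϱ s - Kerr.rMinus M a)))
    (h8 : ∀ s, σ₅ ≤ s → 8 * M < ϱ s)
    (hX : ∀ u : E3, X u =
      !₂[(ϱ ‖u‖ * (Real.cos (α ‖u‖) * u 0 - Real.sin (α ‖u‖) * u 1) -
            a * (Real.sin (α ‖u‖) * u 0 + Real.cos (α ‖u‖) * u 1)) / ‖u‖,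
         (ϱ ‖u‖ * (Real.sin (α ‖u‖) * u 0 + Real.cos (α ‖u‖) * u 1) +
            a * (Real.cos (α ‖u‖) * u 0 - Real.sin (α ‖u‖) * u 1)) / ‖u‖,
         ϱ ‖u‖ * u 2 / ‖u‖])
    {u : E3} (hu : σ₅ < ‖u‖) (t : ℝ) (w : E3) :
    Kerr.bilin M a (E4.ofTimeSpace t (X u)) (E4.basisVector 0)
        (fderiv ℝ (fun u : E3 ↦ E4.ofTimeSpace (τ ‖u‖) (X u)) u w) =
      -(2 * M * ϱ ‖u‖ * a / (ϱ ‖u‖ ^ 2 * ‖u‖ ^ 2 + a ^ 2 * u 2 ^ 2)) * (u 0 * w 1 - u 1 * w 0) := by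
  have hs0 : 0 < ‖u‖ := hσ₅.trans hu
  have hs : ‖u‖ ≠ 0 := hs0.ne'
  have hu0 : u ≠ 0 := norm_ne_zero_iff.1 hs
  have hM := Negative.mass_pos ha
  obtain ⟨_, hϱs, _⟩ := hfar ‖u‖ hu.le
  have hrp : Kerr.rPlus M a < ϱ ‖u‖ := rPlus_lt_far ha h8 hu.le
  have hr0 : 0 < ϱ ‖u‖ := by linarith [h8 ‖u‖ hu.le]
  have hΔ : ϱ ‖u‖ ^ 2 - 2 * M * ϱ ‖u‖ + a ^ 2 ≠ 0 := (Negative.delta_pos ha hrp).ne'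
  have hS : ϱ ‖u‖ ^ 2 * ‖u‖ ^ 2 + a ^ 2 * u 2 ^ 2 ≠ 0 := by positivity
  have hdτ : deriv τ ‖u‖ = 2 * M * ϱ ‖u‖ / (ϱ ‖u‖ ^ 2 - 2 * M * ϱ ‖u‖ + a ^ 2) * deriv ϱ ‖u‖ :=
    deriv_far_tau ha hϱ (fun s hs' ↦ (hfar s hs').1) (h8 ‖u‖ hu.le).le hu
  have hdα : deriv α ‖u‖ = a / (ϱ ‖u‖ ^ 2 - 2 * M * ϱ ‖u‖ + a ^ 2) * deriv ϱ ‖u‖ :=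
    deriv_far_alpha ha hϱ (fun s hs' ↦ (hfar s hs').2.2) hrp hu
  rw [fderiv_capImm_apply hX hτ hϱ hα hu0 w, Kerr.bilin_apply, Minkowski.bilin_basisVector_zero_left,
    Kerr.nullCovector_basisVector_zero, nullCovector_capImm hX hu0 hr0, scalarH_capImm hX hu0 hr0,
    E4.ofTimeSpace_apply_zero]
  obtain ⟨h0w, h1w, h2w⟩ := fderiv_capMap_apply hX hϱ hα hu0 w
  have hcs := Real.sin_sq_add_cos_sq (α ‖u‖)
  have huw := Kerr.Ingoing.inner_e3 u w
  have hn := E3.norm_sq u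
  have hℓw := capFar_ell (ωv := u 0 * w 1 - u 1 * w 0) hs h0w h1w h2w
    (by rw [huw]; linear_combination (u 0 * w 0 + u 1 * w 1) * hcs)
    (by linear_combination (u 0 * w 1 - u 1 * w 0) * hcs)
    (by rw [hn]; linear_combination (u 0 ^ 2 + u 1 ^ 2) * hcs)
  rw [hℓw]
  exact capFarK_e0 hs hS hΔ rfl rfl hdτ hdα

/-- **`h(b, w) = g(DΦ(u)(b u), DΦ(u) w) = −2Mra(u₀w₁ − u₁w₀)/Σ_s`** on the far zone for the shift field
`b u = β(u) ẑ × u`, `β = −2Mras²/A_s`, `A_s = (r² + a²)²s² − Δa²(s² − u₂²)` (`= s²A`,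
`A = (r² + a²)² − Δa² sin²θ`): the closed form of the induced metric (`bilin_fderiv_capFar`) on `b u` with
`⟪b u, w⟫ = βω(w)`, `ω(b u) = β(s² − u₂²)`. Bardeen–Press–Teukolsky 1972, (2.3) (`ω = 2Mar/A`).
[cite: BrandtSeidel1996, §II] -/
theorem bilin_shift_fderiv_capFar (ha : |a| < M) (hσ₅ : 0 < σ₅)
    (hτ : ContDiff ℝ ∞ τ) (hϱ : ContDiff ℝ ∞ ϱ) (hα : ContDiff ℝ ∞ α)
    (hfar : ∀ s, σ₅ ≤ s → τ s = Negative.bentHeight M a (ϱ s) + c ∧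
      ϱ s = s + M + (M ^ 2 - a ^ 2) / (4 * s) ∧
      α s = a / (Kerr.rPlus M a - Kerr.rMinus M a) *
        Real.log ((ϱ s - Kerr.rPlus M a) / (ϱ s - Kerr.rMinus M a)))
    (h8 : ∀ s, σ₅ ≤ s → 8 * M < ϱ s)
    (hX : ∀ u : E3, X u =
      !₂[(ϱ ‖u‖ * (Real.cos (α ‖u‖) * u 0 - Real.sin (α ‖u‖) * u 1) -
            a * (Real.sin (α ‖u‖) * u 0 + Real.cos (α ‖u‖) * u 1)) / ‖u‖,
         (ϱ ‖u‖ * (Real.sin (α ‖u‖) * u 0 + Real.cos (α ‖u‖) * u 1) +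
            a * (Real.cos (α ‖u‖) * u 0 - Real.sin (α ‖u‖) * u 1)) / ‖u‖,
         ϱ ‖u‖ * u 2 / ‖u‖])
    {b : E3 → E3}
    (hb : ∀ u : E3, b u = (-(2 * M * ϱ ‖u‖ * a * ‖u‖ ^ 2 /
        ((ϱ ‖u‖ ^ 2 + a ^ 2) ^ 2 * ‖u‖ ^ 2 -
          (ϱ ‖u‖ ^ 2 - 2 * M * ϱ ‖u‖ + a ^ 2) * a ^ 2 * (‖u‖ ^ 2 - u 2 ^ 2)))) • !₂[-u 1, u 0, 0])
    {u : E3} (hu : σ₅ < ‖u‖) (t : ℝ) (w : E3) :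
    Kerr.bilin M a (E4.ofTimeSpace t (X u)) (fderiv ℝ (fun u : E3 ↦ E4.ofTimeSpace (τ ‖u‖) (X u)) u (b u))
        (fderiv ℝ (fun u : E3 ↦ E4.ofTimeSpace (τ ‖u‖) (X u)) u w) =
      -(2 * M * ϱ ‖u‖ * a / (ϱ ‖u‖ ^ 2 * ‖u‖ ^ 2 + a ^ 2 * u 2 ^ 2)) * (u 0 * w 1 - u 1 * w 0) := by
  have hs0 : 0 < ‖u‖ := hσ₅.trans hu
  have hs : ‖u‖ ≠ 0 := hs0.ne'
  have hM := Negative.mass_pos ha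
  have hrp : Kerr.rPlus M a < ϱ ‖u‖ := rPlus_lt_far ha h8 hu.le
  have hr0 : 0 < ϱ ‖u‖ := by linarith [h8 ‖u‖ hu.le]
  have hΔ0 : 0 < ϱ ‖u‖ ^ 2 - 2 * M * ϱ ‖u‖ + a ^ 2 := Negative.delta_pos ha hrp
  have hS0 : 0 < ϱ ‖u‖ ^ 2 * ‖u‖ ^ 2 + a ^ 2 * u 2 ^ 2 := by positivity
  have hA0 : 0 < (ϱ ‖u‖ ^ 2 + a ^ 2) ^ 2 * ‖u‖ ^ 2 -
      (ϱ ‖u‖ ^ 2 - 2 * M * ϱ ‖u‖ + a ^ 2) * a ^ 2 * (‖u‖ ^ 2 - u 2 ^ 2) := by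
    rw [capFarK_A_eq]; positivity
  rw [bilin_fderiv_capFar ha hσ₅ hτ hϱ hα hfar h8 hX hu t (b u) w]
  set β : ℝ := -(2 * M * ϱ ‖u‖ * a * ‖u‖ ^ 2 /
    ((ϱ ‖u‖ ^ 2 + a ^ 2) ^ 2 * ‖u‖ ^ 2 -
      (ϱ ‖u‖ ^ 2 - 2 * M * ϱ ‖u‖ + a ^ 2) * a ^ 2 * (‖u‖ ^ 2 - u 2 ^ 2))) with hβ
  have hb0 : b u 0 = -(β * u 1) := by rw [hb u, ← hβ]; simp
  have hb1 : b u 1 = β * u 0 := by rw [hb u, ← hβ]; simp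
  have hb2 : b u 2 = 0 := by rw [hb u, ← hβ]; simp
  have hinner : ⟪b u, w⟫_ℝ = β * (u 0 * w 1 - u 1 * w 0) := by
    rw [Kerr.Ingoing.inner_e3, hb0, hb1, hb2]; ring
  have hω : u 0 * b u 1 - u 1 * b u 0 = β * (‖u‖ ^ 2 - u 2 ^ 2) := by
    rw [hb0, hb1, E3.norm_sq]; ring
  rw [hinner, hω]
  exact capFarK_shift hs hS0.ne' hA0.ne' rfl rfl hβ


/-! ### The future unit normal on the far zone: `N = m (∂_{t*} − DΦ b)` -/

/-- **Lapse–shift splitting of the Killing vector along the far zone of the cap**: with the shift field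
`b u = β(u) ẑ × u`, `β = −2Mras²/A_s` and `m = (A_s/(Σ_sΔ))^{1/2}` (`= 1/N_lapse`, `N_lapse² = ΣΔ/A`), the
vector `∂_{t*} − DΦ(u)(b u)` is `g`-orthogonal to `DΦ(u)(E3)`, has `g`-square `−Σ_sΔ/A_s`, and
`m(∂_{t*} − DΦ b)` is a future unit timelike vector: `g(V, ·) = −m < 0` for `V = −g♯dt*`
(`(DΦ b)⁰ = τ′⟪u, b⟫/s = 0`). Bardeen–Press–Teukolsky 1972, (2.3)–(2.5) (`e^{2ν} = ΣΔ/A`, `ω = 2Mar/A`);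
Wald 1984, §10.2. [cite: BrandtSeidel1996, §II] [cite: Wald1984, §10.2] -/
theorem capFar_lapseShift (ha : |a| < M) (hσ₅ : 0 < σ₅)
    (hτ : ContDiff ℝ ∞ τ) (hϱ : ContDiff ℝ ∞ ϱ) (hα : ContDiff ℝ ∞ α)
    (hfar : ∀ s, σ₅ ≤ s → τ s = Negative.bentHeight M a (ϱ s) + c ∧
      ϱ s = s + M + (M ^ 2 - a ^ 2) / (4 * s) ∧
      α s = a / (Kerr.rPlus M a - Kerr.rMinus M a) *
        Real.log ((ϱ s - Kerr.rPlus M a) / (ϱ s - Kerr.rMinus M a)))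
    (h8 : ∀ s, σ₅ ≤ s → 8 * M < ϱ s)
    (hX : ∀ u : E3, X u =
      !₂[(ϱ ‖u‖ * (Real.cos (α ‖u‖) * u 0 - Real.sin (α ‖u‖) * u 1) -
            a * (Real.sin (α ‖u‖) * u 0 + Real.cos (α ‖u‖) * u 1)) / ‖u‖,
         (ϱ ‖u‖ * (Real.sin (α ‖u‖) * u 0 + Real.cos (α ‖u‖) * u 1) +
            a * (Real.cos (α ‖u‖) * u 0 - Real.sin (α ‖u‖) * u 1)) / ‖u‖,
         ϱ ‖u‖ * u 2 / ‖u‖])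
    {b : E3 → E3} {m : E3 → ℝ}
    (hb : ∀ u : E3, b u = (-(2 * M * ϱ ‖u‖ * a * ‖u‖ ^ 2 /
        ((ϱ ‖u‖ ^ 2 + a ^ 2) ^ 2 * ‖u‖ ^ 2 -
          (ϱ ‖u‖ ^ 2 - 2 * M * ϱ ‖u‖ + a ^ 2) * a ^ 2 * (‖u‖ ^ 2 - u 2 ^ 2)))) • !₂[-u 1, u 0, 0])
    (hm : ∀ u : E3, m u = Real.sqrt (((ϱ ‖u‖ ^ 2 + a ^ 2) ^ 2 * ‖u‖ ^ 2 -
          (ϱ ‖u‖ ^ 2 - 2 * M * ϱ ‖u‖ + a ^ 2) * a ^ 2 * (‖u‖ ^ 2 - u 2 ^ 2)) /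
        ((ϱ ‖u‖ ^ 2 * ‖u‖ ^ 2 + a ^ 2 * u 2 ^ 2) * (ϱ ‖u‖ ^ 2 - 2 * M * ϱ ‖u‖ + a ^ 2))))
    {u : E3} (hu : σ₅ < ‖u‖) :
    (∀ w : E3, Kerr.bilin M a (E4.ofTimeSpace (τ ‖u‖) (X u))
        (E4.basisVector 0 - fderiv ℝ (fun u : E3 ↦ E4.ofTimeSpace (τ ‖u‖) (X u)) u (b u))
        (fderiv ℝ (fun u : E3 ↦ E4.ofTimeSpace (τ ‖u‖) (X u)) u w) = 0) ∧
      Kerr.bilin M a (E4.ofTimeSpace (τ ‖u‖) (X u))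
        (m u • (E4.basisVector 0 - fderiv ℝ (fun u : E3 ↦ E4.ofTimeSpace (τ ‖u‖) (X u)) u (b u)))
        (m u • (E4.basisVector 0 - fderiv ℝ (fun u : E3 ↦ E4.ofTimeSpace (τ ‖u‖) (X u)) u (b u))) = -1 ∧
      Kerr.bilin M a (E4.ofTimeSpace (τ ‖u‖) (X u)) (Kerr.timeVector M a (E4.ofTimeSpace (τ ‖u‖) (X u)))
        (m u • (E4.basisVector 0 - fderiv ℝ (fun u : E3 ↦ E4.ofTimeSpace (τ ‖u‖) (X u)) u (b u))) < 0 := by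
  have hs0 : 0 < ‖u‖ := hσ₅.trans hu
  have hs : ‖u‖ ≠ 0 := hs0.ne'
  have hu0 : u ≠ 0 := norm_ne_zero_iff.1 hs
  have hM := Negative.mass_pos ha
  have hrp : Kerr.rPlus M a < ϱ ‖u‖ := rPlus_lt_far ha h8 hu.le
  have hr0 : 0 < ϱ ‖u‖ := by linarith [h8 ‖u‖ hu.le]
  have hΔ0 : 0 < ϱ ‖u‖ ^ 2 - 2 * M * ϱ ‖u‖ + a ^ 2 := Negative.delta_pos ha hrp
  have hS0 : 0 < ϱ ‖u‖ ^ 2 * ‖u‖ ^ 2 + a ^ 2 * u 2 ^ 2 := by positivity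
  have hA0 : 0 < (ϱ ‖u‖ ^ 2 + a ^ 2) ^ 2 * ‖u‖ ^ 2 -
      (ϱ ‖u‖ ^ 2 - 2 * M * ϱ ‖u‖ + a ^ 2) * a ^ 2 * (‖u‖ ^ 2 - u 2 ^ 2) := by
    rw [capFarK_A_eq]; positivity
  have hrad : 0 < Kerr.radius a (E4.ofTimeSpace (τ ‖u‖) (X u)) := by
    rw [radius_capMap hX hu0 hr0]; exact hr0
  set β : ℝ := -(2 * M * ϱ ‖u‖ * a * ‖u‖ ^ 2 /
    ((ϱ ‖u‖ ^ 2 + a ^ 2) ^ 2 * ‖u‖ ^ 2 -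
      (ϱ ‖u‖ ^ 2 - 2 * M * ϱ ‖u‖ + a ^ 2) * a ^ 2 * (‖u‖ ^ 2 - u 2 ^ 2))) with hβ
  have hb0 : b u 0 = -(β * u 1) := by rw [hb u, ← hβ]; simp
  have hb1 : b u 1 = β * u 0 := by rw [hb u, ← hβ]; simp
  have hb2 : b u 2 = 0 := by rw [hb u, ← hβ]; simp
  have hub : ⟪u, b u⟫_ℝ = 0 := by rw [Kerr.Ingoing.inner_e3, hb0, hb1, hb2]; ring
  have hω : u 0 * b u 1 - u 1 * b u 0 = β * (‖u‖ ^ 2 - u 2 ^ 2) := by rw [hb0, hb1, E3.norm_sq]; ring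
  -- the two pairings with `DΦ w`
  have hA := fun w ↦ bilin_basisVector_fderiv_capFar ha hσ₅ hτ hϱ hα hfar h8 hX hu (τ ‖u‖) w
  have hB := fun w ↦ bilin_shift_fderiv_capFar ha hσ₅ hτ hϱ hα hfar h8 hX hb hu (τ ‖u‖) w
  have hnormal : ∀ w : E3, Kerr.bilin M a (E4.ofTimeSpace (τ ‖u‖) (X u))
      (E4.basisVector 0 - fderiv ℝ (fun u : E3 ↦ E4.ofTimeSpace (τ ‖u‖) (X u)) u (b u))
      (fderiv ℝ (fun u : E3 ↦ E4.ofTimeSpace (τ ‖u‖) (X u)) u w) = 0 := fun w ↦ by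
    rw [map_sub, _root_.sub_apply, hA w, hB w, sub_self]
  -- the square
  have h00 : Kerr.bilin M a (E4.ofTimeSpace (τ ‖u‖) (X u)) (E4.basisVector 0) (E4.basisVector 0) =
      -1 + 2 * (M * ϱ ‖u‖ * ‖u‖ ^ 2 / (ϱ ‖u‖ ^ 2 * ‖u‖ ^ 2 + a ^ 2 * u 2 ^ 2)) * (1 * 1) := by
    rw [Kerr.bilin_apply, Minkowski.bilin_basisVector_zero, Kerr.nullCovector_basisVector_zero,
      scalarH_capImm hX hu0 hr0]
  have hsq : Kerr.bilin M a (E4.ofTimeSpace (τ ‖u‖) (X u))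
      (E4.basisVector 0 - fderiv ℝ (fun u : E3 ↦ E4.ofTimeSpace (τ ‖u‖) (X u)) u (b u))
      (E4.basisVector 0 - fderiv ℝ (fun u : E3 ↦ E4.ofTimeSpace (τ ‖u‖) (X u)) u (b u)) =
      -((ϱ ‖u‖ ^ 2 * ‖u‖ ^ 2 + a ^ 2 * u 2 ^ 2) * (ϱ ‖u‖ ^ 2 - 2 * M * ϱ ‖u‖ + a ^ 2) /
        ((ϱ ‖u‖ ^ 2 + a ^ 2) ^ 2 * ‖u‖ ^ 2 -
          (ϱ ‖u‖ ^ 2 - 2 * M * ϱ ‖u‖ + a ^ 2) * a ^ 2 * (‖u‖ ^ 2 - u 2 ^ 2))) := by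
    have hBA : Kerr.bilin M a (E4.ofTimeSpace (τ ‖u‖) (X u))
        (fderiv ℝ (fun u : E3 ↦ E4.ofTimeSpace (τ ‖u‖) (X u)) u (b u)) (E4.basisVector 0) =
        Kerr.bilin M a (E4.ofTimeSpace (τ ‖u‖) (X u)) (E4.basisVector 0)
          (fderiv ℝ (fun u : E3 ↦ E4.ofTimeSpace (τ ‖u‖) (X u)) u (b u)) := Kerr.bilin_symm M a _ _ _
    simp only [map_sub, _root_.sub_apply]
    rw [hBA, hB (b u), hA (b u), h00, hω]
    have key := capFarK_unit (M := M) (a := a) (r := ϱ ‖u‖) (s := ‖u‖) (u2 := u 2) hS0.ne' hA0.ne' rfl rfl rfl hβ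
    linear_combination key
  set Q : ℝ := ((ϱ ‖u‖ ^ 2 + a ^ 2) ^ 2 * ‖u‖ ^ 2 -
      (ϱ ‖u‖ ^ 2 - 2 * M * ϱ ‖u‖ + a ^ 2) * a ^ 2 * (‖u‖ ^ 2 - u 2 ^ 2)) /
    ((ϱ ‖u‖ ^ 2 * ‖u‖ ^ 2 + a ^ 2 * u 2 ^ 2) * (ϱ ‖u‖ ^ 2 - 2 * M * ϱ ‖u‖ + a ^ 2)) with hQ
  have hQ0 : 0 < Q := by positivity
  have hmu : m u = Real.sqrt Q := hm u
  have hm0 : 0 < m u := by rw [hmu]; exact Real.sqrt_pos.2 hQ0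
  have hm2 : m u * m u = Q := by rw [hmu]; exact Real.mul_self_sqrt hQ0.le
  refine ⟨hnormal, ?_, ?_⟩
  · simp only [map_smul, smul_eq_mul, FunLike.coe_smul, Pi.smul_apply]
    rw [hsq, ← mul_assoc, hm2, hQ, mul_neg, div_mul_div_comm, neg_inj, div_eq_one_iff_eq (by positivity)]
    ring
  · rw [map_smul, smul_eq_mul, map_sub, Kerr.bilin_timeVector hrad, Kerr.bilin_timeVector hrad,
      fderiv_capImm_apply hX hτ hϱ hα hu0 (b u), E4.ofTimeSpace_apply_zero, hub]
    simp only [PiLp.single_apply, if_true, mul_zero, neg_zero, sub_zero, mul_neg, mul_one,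
      neg_lt_zero]
    exact hm0


/-- **On the far zone the future unit normal of the cap map IS `m(∂_{t*} − DΦ b)`**: whatever future unit normal
field `N` along `Ψ` is given, at a point `u` with `‖u‖ > σ₅` it coincides with the lapse–shift normal of
`capFar_lapseShift` — both are future unit normals to the spacelike hyperplane `dΨ_u(E3)` (positive definite by
the closed form of the induced metric, `bilin_fderiv_capFar`), and such a normal is unique
(`LorentzianMetric.eq_of_normal_of_unit_of_isFutureDirected`). O'Neill 1983, Ch. 5, Lemma 5.26; Wald 1984, §10.2.
[cite: ONeill1983, Ch. 5 Lemma 5.26] [cite: Wald1984, §10.2] -/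
theorem capFar_normal_eq [Kerr.Facts] {rc : ℝ} {Ω : Opens E3} {Ψ : Ω → Kerr.region a rc} {N : E3 → E4}
    (hMn : 0 ≤ M) (ha : |a| < M) (hσ₅ : 0 < σ₅)
    (hτ : ContDiff ℝ ∞ τ) (hϱ : ContDiff ℝ ∞ ϱ) (hα : ContDiff ℝ ∞ α)
    (hfar : ∀ s, σ₅ ≤ s → τ s = Negative.bentHeight M a (ϱ s) + c ∧
      ϱ s = s + M + (M ^ 2 - a ^ 2) / (4 * s) ∧
      α s = a / (Kerr.rPlus M a - Kerr.rMinus M a) *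
        Real.log ((ϱ s - Kerr.rPlus M a) / (ϱ s - Kerr.rMinus M a)))
    (h8 : ∀ s, σ₅ ≤ s → 8 * M < ϱ s)
    (hX : ∀ u : E3, X u =
      !₂[(ϱ ‖u‖ * (Real.cos (α ‖u‖) * u 0 - Real.sin (α ‖u‖) * u 1) -
            a * (Real.sin (α ‖u‖) * u 0 + Real.cos (α ‖u‖) * u 1)) / ‖u‖,
         (ϱ ‖u‖ * (Real.sin (α ‖u‖) * u 0 + Real.cos (α ‖u‖) * u 1) +
            a * (Real.cos (α ‖u‖) * u 0 - Real.sin (α ‖u‖) * u 1)) / ‖u‖,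
         ϱ ‖u‖ * u 2 / ‖u‖])
    {b : E3 → E3} {m : E3 → ℝ}
    (hb : ∀ u : E3, b u = (-(2 * M * ϱ ‖u‖ * a * ‖u‖ ^ 2 /
        ((ϱ ‖u‖ ^ 2 + a ^ 2) ^ 2 * ‖u‖ ^ 2 -
          (ϱ ‖u‖ ^ 2 - 2 * M * ϱ ‖u‖ + a ^ 2) * a ^ 2 * (‖u‖ ^ 2 - u 2 ^ 2)))) • !₂[-u 1, u 0, 0])
    (hm : ∀ u : E3, m u = Real.sqrt (((ϱ ‖u‖ ^ 2 + a ^ 2) ^ 2 * ‖u‖ ^ 2 -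
          (ϱ ‖u‖ ^ 2 - 2 * M * ϱ ‖u‖ + a ^ 2) * a ^ 2 * (‖u‖ ^ 2 - u 2 ^ 2)) /
        ((ϱ ‖u‖ ^ 2 * ‖u‖ ^ 2 + a ^ 2 * u 2 ^ 2) * (ϱ ‖u‖ ^ 2 - 2 * M * ϱ ‖u‖ + a ^ 2))))
    (hΨ : ∀ u : Ω, (Ψ u : E4) = E4.ofTimeSpace (τ ‖(u : E3)‖) (X u))
    (hN : (Kerr.smoothMetric M a rc).IsFutureUnitNormal 𝓘(ℝ, E3)
      ((Kerr.timeOrientation M a rc hMn).ofLE le_top) Ψ (fun u ↦ N u))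
    (u : Ω) (hu : σ₅ < ‖(u : E3)‖) :
    N u = m u • (E4.basisVector 0 -
      fderiv ℝ (fun u : E3 ↦ E4.ofTimeSpace (τ ‖u‖) (X u)) u (b u)) := by
  have hs0 : 0 < ‖(u : E3)‖ := hσ₅.trans hu
  have hu0 : (u : E3) ≠ 0 := norm_ne_zero_iff.1 hs0.ne'
  have hM := Negative.mass_pos ha
  have hr0 : 0 < ϱ ‖(u : E3)‖ := by linarith [h8 ‖(u : E3)‖ hu.le]
  have hS0 : 0 < ϱ ‖(u : E3)‖ ^ 2 * ‖(u : E3)‖ ^ 2 + a ^ 2 * (u : E3) 2 ^ 2 := by positivity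
  have hd : DifferentiableAt ℝ (fun u : E3 ↦ E4.ofTimeSpace (τ ‖u‖) (X u)) (u : E3) :=
    differentiableAt_capImm hX hτ hϱ hα hu0
  have hdim : Module.finrank ℝ E4 = Module.finrank ℝ E3 + 1 := by
    rw [finrank_euclideanSpace_fin, finrank_euclideanSpace_fin]
  obtain ⟨hnormal, hunit, hfut⟩ := capFar_lapseShift ha hσ₅ hτ hϱ hα hfar h8 hX hb hm hu
  have hpt : (Ψ u : E4) = E4.ofTimeSpace (τ ‖(u : E3)‖) (X u) := hΨ u
  refine ((Kerr.smoothMetric M a rc).eq_of_normal_of_unit_of_isFutureDirected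
    ((Kerr.timeOrientation M a rc hMn).ofLE le_top) hdim (mfderiv 𝓘(ℝ, E3) 𝓘(ℝ, E4) Ψ u)
    (fun v hv ↦ ?_) (fun v ↦ hN.1.1 u v) (fun v ↦ ?_) (hN.1.2 u) ?_ (hN.2 u) ⟨?_, ?_⟩).symm
  · -- positivity of the induced form on the far zone
    show 0 < (Kerr.smoothMetric M a rc).val (Ψ u) (mfderiv 𝓘(ℝ, E3) 𝓘(ℝ, E4) Ψ u v)
      (mfderiv 𝓘(ℝ, E3) 𝓘(ℝ, E4) Ψ u v)
    rw [Kerr.smoothMetric_val, OpensChart.mfderiv_apply_of_repr hΨ hd v]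
    show 0 < Kerr.bilin M a (Ψ u : E4) _ _
    rw [hpt, bilin_fderiv_capFar ha hσ₅ hτ hϱ hα hfar h8 hX hu _ v v, real_inner_self_eq_norm_sq]
    have h1 : 0 < ‖v‖ ^ 2 := by positivity
    have h2 : 0 ≤ ((u : E3) 0 * v 1 - (u : E3) 1 * v 0) * ((u : E3) 0 * v 1 - (u : E3) 1 * v 0) :=
      mul_self_nonneg _
    have h3 : 0 ≤ a ^ 2 * (ϱ ‖(u : E3)‖ ^ 2 * ‖(u : E3)‖ ^ 2 + 2 * M * ϱ ‖(u : E3)‖ * ‖(u : E3)‖ ^ 2 +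
        a ^ 2 * (u : E3) 2 ^ 2) / ((ϱ ‖(u : E3)‖ ^ 2 * ‖(u : E3)‖ ^ 2 + a ^ 2 * (u : E3) 2 ^ 2) * ‖(u : E3)‖ ^ 4) := by
      positivity
    have h4 : 0 < (ϱ ‖(u : E3)‖ ^ 2 * ‖(u : E3)‖ ^ 2 + a ^ 2 * (u : E3) 2 ^ 2) / ‖(u : E3)‖ ^ 4 := by positivity
    nlinarith [mul_nonneg h3 h2, mul_pos h4 h1]
  · -- normality of `m(∂_{t*} − DΦ b)`
    show (Kerr.smoothMetric M a rc).val (Ψ u) (m u • (E4.basisVector 0 -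
      fderiv ℝ (fun u : E3 ↦ E4.ofTimeSpace (τ ‖u‖) (X u)) u (b u))) (mfderiv 𝓘(ℝ, E3) 𝓘(ℝ, E4) Ψ u v) = 0
    rw [Kerr.smoothMetric_val, OpensChart.mfderiv_apply_of_repr hΨ hd v]
    show Kerr.bilin M a (Ψ u : E4) _ _ = 0
    rw [hpt, map_smul, FunLike.coe_smul, Pi.smul_apply, hnormal v, smul_zero]
  · -- unit
    rw [Kerr.smoothMetric_val]
    show Kerr.bilin M a (Ψ u : E4) _ _ = -1
    rw [hpt]
    exact hunit
  · -- causal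
    have ht : (Kerr.smoothMetric M a rc).IsTimelike (x := Ψ u) (m u • (E4.basisVector 0 -
        fderiv ℝ (fun u : E3 ↦ E4.ofTimeSpace (τ ‖u‖) (X u)) u (b u))) := by
      rw [LorentzianMetric.isTimelike_iff, Kerr.smoothMetric_val]
      show Kerr.bilin M a (Ψ u : E4) _ _ < 0
      rw [hpt, hunit]
      norm_num
    exact ht.isCausal
  · -- future
    rw [TimeOrientation.vectorField_ofLE, Kerr.smoothMetric_val]
    show Kerr.bilin M a (Ψ u : E4) (Kerr.timeVector M a (Ψ u : E4)) _ < 0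
    rw [hpt]
    exact hfut

end Far

end KerrCap

/-- **Registered export of this file** (sub-goal `cap_farShift` of stub `stub_capFarK`): the pairing of the Killing
vector `∂_{t*}` with the tangent vectors of the cap on the far zone, `KerrCap.bilin_basisVector_fderiv_capFar`.
[cite: BrandtSeidel1996, §II] -/
theorem cap_farShift : ∀ {M a c σ₅ : ℝ} {τ ϱ α : ℝ → ℝ} {X : E3 → E3}, |a| < M → 0 < σ₅ → ContDiff ℝ ∞ τ → ContDiff ℝ ∞ ϱ → ContDiff ℝ ∞ α → (∀ s, σ₅ ≤ s → τ s = Negative.bentHeight M a (ϱ s) + c ∧ ϱ s = s + M + (M ^ 2 - a ^ 2) / (4 * s) ∧ α s = a / (Kerr.rPlus M a - Kerr.rMinus M a) * Real.log ((ϱ s - Kerr.rPlus M a) / (ϱ s - Kerr.rMinus M a))) → (∀ s, σ₅ ≤ s → 8 * M < ϱ s) → (∀ u : E3, X u = !₂[(ϱ ‖u‖ * (Real.cos (α ‖u‖) * u 0 - Real.sin (α ‖u‖) * u 1) - a * (Real.sin (α ‖u‖) * u 0 + Real.cos (α ‖u‖) * u 1)) / ‖u‖, (ϱ ‖u‖ *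 (Real.sin (α ‖u‖) * u 0 + Real.cos (α ‖u‖) * u 1) + a * (Real.cos (α ‖u‖) * u 0 - Real.sin (α ‖u‖) * u 1)) / ‖u‖, ϱ ‖u‖ * u 2 / ‖u‖]) → ∀ {u : E3}, σ₅ < ‖u‖ → ∀ (t : ℝ) (w : E3), Kerr.bilin M a (E4.ofTimeSpace t (X u)) (E4.basisVector 0) (fderiv ℝ (fun u : E3 ↦ E4.ofTimeSpace (τ ‖u‖) (X u)) u w) = -(2 * M * ϱ ‖u‖ * a / (ϱ ‖u‖ ^ 2 * ‖u‖ ^ 2 + a ^ 2 * u 2 ^ 2)) * (u 0 * w 1 - u 1 * w 0) :=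
  fun ha hσ₅ hτ hϱ hα hfar h8 hX _ hu t w ↦ KerrCap.bilin_basisVector_fderiv_capFar ha hσ₅ hτ hϱ hα hfar h8 hX hu t w

end Summit.FinalStateConjecture.FinalStateConjecture.Theorems.SwallowTheDatum

end
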